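import Literature.AlgebraicGeometry.Kloosterman2025.PencilOfPairingsKernelBounds
import Literature.LinearAlgebra.Matrix.PencilRankDropCount
import HarnessLib

/-!
# Kloosterman's count of exceptional values in a pencil of two pairings (Thm. 3.13, second part)

R. Kloosterman, *On a conjecture on Hodge loci of linear combinations of linear subvarieties*,
Rend. Circ. Mat. Palermo (2) (2025), doi:10.1007/s12215-025-01307-4 = arXiv:2312.12363, §2.3 'Bilinear maps'
[cite: Kloosterman2025, Notation 2.4, Lemma 2.5, Lemma 2.6] and §3 [cite: Kloosterman2025, Lemma 3.12, Thm. 3.13].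
Third file of the series `PencilOfPairingsLeftKernel.lean` (Lemma 2.9), `PencilOfPairingsKernelBounds.lean`
(Lemma 2.8, pointwise bounds); same encoding: a pairing `φ : V × W → K` is `B : V →ₗ[K] W →ₗ[K] K`,
`ker_L(φ) = LinearMap.ker B`, `r = rank φ = dim range B` (`= dim range B.flip`, `finrank_range_flip_eq`).

**Printed statements (verbatim).** [cite: Kloosterman2025, Lemma 2.6]: "Using the above notation, suppose
`s₁ = dim V − r₁` holds, i.e., `ker_L φ₂|_{V₁×W₁} = 0`, then for at most `dim V − s₁ − s₂` nonzero values of `t`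
we have the strict inequality `rank φ₁+tφ₂ < dim V`." Its printed proof begins: "Pick bases for `V` and `W`.
Let `A_i` be the Gram matrix of `φ_i`. The values of `t` for which the rank of `A₁+tA₂` is less than `dim V` are
precisely the common zeros of all maximal minors of `A₁+tA₂`, which are polynomials in `t` …". In the proof of
[cite: Kloosterman2025, Thm. 3.13]: "From the previous lemma it follows that
`T_X NL([Y₁]+λ[Y₂])/T_X NL([Y₁],[Y₂])` equals `ker_L(ψ₁+ν(λ)ψ₂)`. … From Lemma (lemSpectrumSize) it follows that
for at most `dim V−s₁−s₂` nonzero values of `λ` there is a rank drop. In our case `dim ker_L(ψ_j) = dim V−r_j`.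
Since the left kernel is zero, the rank `s_i` of `φ_i` is maximal, hence `s_i = dim V−r_j`. This implies that
there are at most `r₁+r₂−dim V` exceptional values. By construction `r_j = h_{I_j}(d)` and `dim V = h_{I_j∩I_j}(d)`.
Using Lemma (lemHP) we obtain `r₁+r₂−dim V = h_{I₁+I₂}(d)`." Hence Thm. 3.13: "… there are at most
`h_{I₁+I₂}(d)` values of `λ ∈ ℚ*` such that `codim T_X NL([Y₁]+λ[Y₂]) < codim T_X NL([Y₁],[Y₂])`."

**What this file proves** (`ncard_leftKernel_ne_bot_add_finrank_le`, sorry-free, any field, `V`, `W`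
finite-dimensional): if ONE member `φ₁ + c₀φ₂` of the pencil has trivial left kernel, then
`#{c ∈ K : c ≠ 0, ker_L(φ₁ + cφ₂) ≠ 0} + dim V ≤ r₁ + r₂`, i.e. there are at most `r₁ + r₂ − dim V` exceptional
non-zero values — the printed conclusion, with the printed hypothesis 'both one-sided kernels vanish' (which
yields a kernel-free member via Lemma 2.5) replaced by the existence of one kernel-free member (what a census
certifies by one exact rank computation). Proof = the printed first step "pick bases, Gram matrices, maximal
minors" made quantitative: with bases `bV`, `bW` the matrix `M(φ) = LinearMap.toMatrix bV bW^∨ (v ↦ φ(v,·))`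
(the transposed Gram matrix, `M(φ)_{ji} = φ(bV_i, bW_j)`) has `rank M(φ) = rank φ` (`rank_toMatrix_dualBasis_eq`)
and `ker_L φ = 0 ⇔ rank M(φ) = dim V` (`ker_eq_bot_iff_card_le_rank`); `M` is linear in `φ`, and the matrix
count `Literature.LinearAlgebra.Matrix.ncard_pencil_rank_lt_card_width_add_le`
(file `Literature/LinearAlgebra/Matrix/PencilRankDropCount.lean`: order and degree of a controlling maximal
minor) gives the bound. The general-excess form `ncard_finrank_leftKernel_gt_add_le` counts, for a pencil whose
generic left kernel has dimension `e₀` (one member with `dim ker_L = e₀` certified... stated as `rank ≥ s`), the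
members with larger kernel: `#{c ≠ 0 : dim V − s < dim ker_L(φ₁ + cφ₂)} + s ≤ r₁ + r₂` whenever
`dim ker_L(φ₁ + c₀φ₂) + s ≤ dim V` for one `c₀`.

**Use in the tree.** With [cite: Kloosterman2025, Lemma 3.12] (`e(λ) := dim T_X NL([Y₁]+λ[Y₂]) −
dim T_X NL([Y₁],[Y₂]) = dim ker_L(ψ₁ + ν(λ)ψ₂)`, `ν` injective, `ψ_j` the Gorenstein pairings of Lemma 2.9 with
`t = (k+1)(d−2)`, `α = d`, so `r_j = h_{I_j}(d)`, `dim V = h_{I₁∩I₂}(d)`): once ONE `λ₀ ∈ ℚ*` with `e(λ₀) = 0` is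
certified, `#{λ ∈ ℚ* : e(λ) > 0} ≤ h_{I₁}(d) + h_{I₂}(d) − h_{I₁∩I₂}(d) = h_{I₁+I₂}(d)`; and for a cell with generic
excess `e₀ > 0` certified at one `λ₀`, `#{λ : e(λ) > e₀} ≤ h_{I₁+I₂}(d) + e₀`. The pointwise companion
`e(λ) ≤ h_{I₁+I₂}(kd−2k−2)` is `finrank_leftKernel_add_smul_le` (previous file). Lemma 3.12, the ideals and the
Hodge loci are NOT formalised; only §2.3's linear algebra is.
-/

namespace Literature.AlgebraicGeometry.Kloosterman2025

open Module

variable {K : Type*} [Field K] {V W : Type*} [AddCommGroup V] [Module K V] [AddCommGroup W] [Module K W]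

section GramMatrix

variable {ι κ : Type*} [Fintype ι] [DecidableEq ι] [Fintype κ] [DecidableEq κ]

/-- "Pick bases for `V` and `W`. Let `A_i` be the Gram matrix of `φ_i`": the matrix of `v ↦ φ(v,·) : V → W^∨`
in the bases `bV`, `bW^∨` is the transposed Gram matrix, `M(φ)_{ji} = φ(bV_i, bW_j)`.
[cite: Kloosterman2025, Lemma 2.6 (proof)] -/
theorem toMatrix_dualBasis_apply (bV : Basis ι K V) (bW : Basis κ K W) (B : V →ₗ[K] W →ₗ[K] K)
    (j : κ) (i : ι) : LinearMap.toMatrix bV bW.dualBasis B j i = B (bV i) (bW j) := by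
  rw [LinearMap.toMatrix_apply, Basis.dualBasis_repr]

/-- The rank of the (transposed) Gram matrix is the rank `r = dim range(v ↦ φ(v,·))` of the pairing
(`r_i = rank φ_i` of [cite: Kloosterman2025, Notation 2.4]). -/
theorem rank_toMatrix_dualBasis_eq (bV : Basis ι K V) (bW : Basis κ K W) (B : V →ₗ[K] W →ₗ[K] K) :
    (LinearMap.toMatrix bV bW.dualBasis B).rank = finrank K (LinearMap.range B) := by
  rw [Matrix.rank_eq_finrank_range_toLin _ bW.dualBasis bV, Matrix.toLin_toMatrix]

/-- `ker_L(φ) = 0` iff the Gram matrix has full rank `dim V` ("the rank of `A₁+tA₂` is less than `dim V`"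
detects a left kernel). [cite: Kloosterman2025, Lemma 2.6 (proof)] -/
theorem ker_eq_bot_iff_card_le_rank (bV : Basis ι K V) (bW : Basis κ K W) (B : V →ₗ[K] W →ₗ[K] K) :
    LinearMap.ker B = ⊥ ↔ Fintype.card ι ≤ (LinearMap.toMatrix bV bW.dualBasis B).rank := by
  haveI : FiniteDimensional K V := Module.Finite.of_basis bV
  rw [rank_toMatrix_dualBasis_eq, ← Module.finrank_eq_card_basis bV]
  constructor
  · intro h
    rw [LinearMap.finrank_range_of_inj (LinearMap.ker_eq_bot.mp h)]
  · intro h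
    have hrn := LinearMap.finrank_range_add_finrank_ker B
    have hk : finrank K (LinearMap.ker B) = 0 := by omega
    exact Submodule.finrank_eq_zero.mp hk

/-- More generally `dim ker_L(φ) + rank M(φ) = dim V` (rank–nullity through the Gram matrix).
[cite: Kloosterman2025, Lemma 2.6 (proof)] -/
theorem finrank_ker_add_rank_toMatrix_dualBasis (bV : Basis ι K V) (bW : Basis κ K W)
    (B : V →ₗ[K] W →ₗ[K] K) :
    finrank K (LinearMap.ker B) + (LinearMap.toMatrix bV bW.dualBasis B).rank = Fintype.card ι := by
  haveI : FiniteDimensional K V := Module.Finite.of_basis bV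
  rw [rank_toMatrix_dualBasis_eq, ← Module.finrank_eq_card_basis bV, add_comm]
  exact LinearMap.finrank_range_add_finrank_ker B

/-- The count in fixed bases: if `ker_L(φ₁ + c₀φ₂) = 0` for one `c₀`, then
`#{c ≠ 0 : ker_L(φ₁ + cφ₂) ≠ 0} + |ι| ≤ r₁ + r₂` (`|ι| = dim V`). [cite: Kloosterman2025, Lemma 2.6, Thm. 3.13 (proof)] -/
theorem ncard_leftKernel_ne_bot_add_card_le (bV : Basis ι K V) (bW : Basis κ K W)
    (B₁ B₂ : V →ₗ[K] W →ₗ[K] K) {c₀ : K} (h0 : LinearMap.ker (B₁ + c₀ • B₂) = ⊥) :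
    {c : K | c ≠ 0 ∧ LinearMap.ker (B₁ + c • B₂) ≠ ⊥}.ncard + Fintype.card ι ≤
      finrank K (LinearMap.range B₁) + finrank K (LinearMap.range B₂) := by
  have hlin : ∀ c : K, LinearMap.toMatrix bV bW.dualBasis (B₁ + c • B₂) =
      LinearMap.toMatrix bV bW.dualBasis B₁ + c • LinearMap.toMatrix bV bW.dualBasis B₂ := fun c => by
    rw [LinearEquiv.map_add, LinearEquiv.map_smul]
  have hset : {c : K | c ≠ 0 ∧ LinearMap.ker (B₁ + c • B₂) ≠ ⊥} =
      {c : K | c ≠ 0 ∧ (LinearMap.toMatrix bV bW.dualBasis B₁ +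
        c • LinearMap.toMatrix bV bW.dualBasis B₂).rank < Fintype.card ι} := by
    ext c
    simp only [Set.mem_setOf_eq, ne_eq, ker_eq_bot_iff_card_le_rank bV bW, hlin, not_le]
  have h0' : Fintype.card ι ≤ (LinearMap.toMatrix bV bW.dualBasis B₁ +
      c₀ • LinearMap.toMatrix bV bW.dualBasis B₂).rank := by
    rw [← hlin]
    exact (ker_eq_bot_iff_card_le_rank bV bW _).mp h0
  have h := Literature.LinearAlgebra.Matrix.ncard_pencil_rank_lt_card_width_add_le _ _ h0'
  rw [rank_toMatrix_dualBasis_eq, rank_toMatrix_dualBasis_eq] at h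
  rw [hset]
  exact h

/-- The general count in fixed bases: if `dim ker_L(φ₁ + c₀φ₂) + s ≤ |ι|` for one `c₀` (the Gram pencil has
rank `≥ s` somewhere), then `#{c ≠ 0 : |ι| − s < dim ker_L(φ₁ + cφ₂)} + s ≤ r₁ + r₂`, i.e. at most
`r₁ + r₂ − s` non-zero members have a left kernel larger than the certified generic bound `|ι| − s`.
[cite: Kloosterman2025, Lemma 2.6, Thm. 3.13 (proof)] (printed for `s = dim V`) -/
theorem ncard_finrank_leftKernel_gt_add_le_of_basis (bV : Basis ι K V) (bW : Basis κ K W)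
    (B₁ B₂ : V →ₗ[K] W →ₗ[K] K) {s : ℕ} {c₀ : K}
    (h0 : finrank K (LinearMap.ker (B₁ + c₀ • B₂)) + s ≤ Fintype.card ι) :
    {c : K | c ≠ 0 ∧ Fintype.card ι - s < finrank K (LinearMap.ker (B₁ + c • B₂))}.ncard + s ≤
      finrank K (LinearMap.range B₁) + finrank K (LinearMap.range B₂) := by
  have hlin : ∀ c : K, LinearMap.toMatrix bV bW.dualBasis (B₁ + c • B₂) =
      LinearMap.toMatrix bV bW.dualBasis B₁ + c • LinearMap.toMatrix bV bW.dualBasis B₂ := fun c => by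
    rw [LinearEquiv.map_add, LinearEquiv.map_smul]
  have hrn : ∀ c : K, finrank K (LinearMap.ker (B₁ + c • B₂)) +
      (LinearMap.toMatrix bV bW.dualBasis B₁ + c • LinearMap.toMatrix bV bW.dualBasis B₂).rank =
        Fintype.card ι := fun c => by
    rw [← hlin]
    exact finrank_ker_add_rank_toMatrix_dualBasis bV bW _
  have hset : {c : K | c ≠ 0 ∧ Fintype.card ι - s < finrank K (LinearMap.ker (B₁ + c • B₂))} =
      {c : K | c ≠ 0 ∧ (LinearMap.toMatrix bV bW.dualBasis B₁ +
        c • LinearMap.toMatrix bV bW.dualBasis B₂).rank < s} := by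
    ext c
    simp only [Set.mem_setOf_eq]
    have := hrn c
    constructor
    · rintro ⟨hc, hlt⟩
      exact ⟨hc, by omega⟩
    · rintro ⟨hc, hlt⟩
      exact ⟨hc, by omega⟩
  have h0' : s ≤ (LinearMap.toMatrix bV bW.dualBasis B₁ +
      c₀ • LinearMap.toMatrix bV bW.dualBasis B₂).rank := by
    have := hrn c₀
    omega
  have h := Literature.LinearAlgebra.Matrix.ncard_pencil_rank_lt_add_le _ _ h0'
  rw [rank_toMatrix_dualBasis_eq, rank_toMatrix_dualBasis_eq] at h
  rw [hset]
  exact h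

end GramMatrix

section Count

variable [FiniteDimensional K V] [FiniteDimensional K W]

/-- **Kloosterman, Thm. 3.13 (second part) / Lemma 2.6, as a statement on pencils of pairings.** Let
`φ₁, φ₂ : V × W → K` be pairings of finite-dimensional spaces with `ker_L(φ₁ + c₀φ₂) = 0` for ONE `c₀`. Then the
number of non-zero `c ∈ K` with `ker_L(φ₁ + cφ₂) ≠ 0` is at most `r₁ + r₂ − dim V` (`r_i = rank φ_i`), stated
additively: `#{c ≠ 0 : ker_L(φ₁ + cφ₂) ≠ 0} + dim V ≤ r₁ + r₂`. ("This implies that there are at most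
`r₁+r₂−dim V` exceptional values.") [cite: Kloosterman2025, Lemma 2.6, Thm. 3.13 (proof)] -/
theorem ncard_leftKernel_ne_bot_add_finrank_le (B₁ B₂ : V →ₗ[K] W →ₗ[K] K) {c₀ : K}
    (h0 : LinearMap.ker (B₁ + c₀ • B₂) = ⊥) :
    {c : K | c ≠ 0 ∧ LinearMap.ker (B₁ + c • B₂) ≠ ⊥}.ncard + finrank K V ≤
      finrank K (LinearMap.range B₁) + finrank K (LinearMap.range B₂) := by
  classical
  have h := ncard_leftKernel_ne_bot_add_card_le (Module.finBasis K V) (Module.finBasis K W) B₁ B₂ h0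
  rwa [Fintype.card_fin] at h

/-- Truncated form: at most `r₁ + r₂ − dim V` non-zero exceptional values.
[cite: Kloosterman2025, Lemma 2.6, Thm. 3.13 (proof)] -/
theorem ncard_leftKernel_ne_bot_le (B₁ B₂ : V →ₗ[K] W →ₗ[K] K) {c₀ : K}
    (h0 : LinearMap.ker (B₁ + c₀ • B₂) = ⊥) :
    {c : K | c ≠ 0 ∧ LinearMap.ker (B₁ + c • B₂) ≠ ⊥}.ncard ≤
      finrank K (LinearMap.range B₁) + finrank K (LinearMap.range B₂) - finrank K V := by
  have h := ncard_leftKernel_ne_bot_add_finrank_le B₁ B₂ h0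
  omega

/-- **General-excess form.** If `dim ker_L(φ₁ + c₀φ₂) + s ≤ dim V` for one `c₀`, then the number of non-zero
`c` with `dim ker_L(φ₁ + cφ₂) > dim V − s` is at most `r₁ + r₂ − s`:
`#{c ≠ 0 : dim V − s < dim ker_L(φ₁ + cφ₂)} + s ≤ r₁ + r₂`. With `s = dim V − e₀` this counts the members whose
excess exceeds a certified generic excess `e₀`: at most `r₁ + r₂ − dim V + e₀` of them.
[cite: Kloosterman2025, Lemma 2.6, Thm. 3.13 (proof)] (printed for `e₀ = 0`) -/
theorem ncard_finrank_leftKernel_gt_add_le (B₁ B₂ : V →ₗ[K] W →ₗ[K] K) {s : ℕ} {c₀ : K}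
    (h0 : finrank K (LinearMap.ker (B₁ + c₀ • B₂)) + s ≤ finrank K V) :
    {c : K | c ≠ 0 ∧ finrank K V - s < finrank K (LinearMap.ker (B₁ + c • B₂))}.ncard + s ≤
      finrank K (LinearMap.range B₁) + finrank K (LinearMap.range B₂) := by
  classical
  have hcard : Fintype.card (Fin (finrank K V)) = finrank K V := Fintype.card_fin _
  have h0' : finrank K (LinearMap.ker (B₁ + c₀ • B₂)) + s ≤ Fintype.card (Fin (finrank K V)) := by
    rw [hcard]; exact h0
  have h := ncard_finrank_leftKernel_gt_add_le_of_basis (Module.finBasis K V) (Module.finBasis K W)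
    B₁ B₂ h0'
  rwa [hcard] at h

end Count

end Literature.AlgebraicGeometry.Kloosterman2025
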